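import Mathlib
import Summits.AtomisticToContinuum.FouriersLaw.Theses.EmbeddedDrudeMourre
import Literature.MathematicalPhysics.KineticTheory.PinnedChainResonantFinite
import HarnessLib

/-!
# Regularity and periodicity of the concrete resonance function and excursion weight
# for stub B1b″ of line `kinetic-polymer-gas-on-the-time-axis`
(crux `EmbeddedDrudeMourre.DrudeDissolution`, item stmt-AtomisticToContinuum-12593; `--supports` file, closes
nothing; lead c13, input (C1) of the twin seat's abstract theorem `cube_secondDiff_of_cutoffFamily`)

WHAT. In the cell order `p = (k₁,(k₃,k₂))` used throughout the B1b″ files: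
* `resonanceFn_cell_contDiff`: `p ↦ Ω(p.1, p.2.2, p.2.1)` is `Cⁿ` for every `n` (the gapped band `ω = √(ω₂ + 2 − 2cos)` is
  analytic);
* `resonanceFn_cell_periodic_fst/_mid/_snd`: the three `2π`-periodicities in the shape consumed by
  `cube_secondDiff_of_cutoffFamily` (`Ω(p.1+2π, p.2.1, p.2.2) = Ω p`, …);
* `excursionWeight_contDiff`, `excursionWeight_nonneg`, `excursionWeight_periodic_fst/_mid/_snd`: the same for the
  bracket-weighted free pair weight `W_f(p) = Φ²·(ω₁ω₂ω₃ω₄)⁻²·[f]²` with a `Cⁿ`, `2π`-periodic profile `f` (the quartic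
  vertex `Φ = a + 16b ∏ sin(kⱼ/2)` is `2π`-periodic in each momentum on the shell `k₄ = k₁+k₂−k₃`: two sine factors flip).

HOW. `analyticAt_dispersion`, composition lemmas for `ContDiff`, `Real.sin_antiperiodic`, `Function.Periodic`.
-/

noncomputable section

open Set Real Topology
open Literature.MathematicalPhysics.KineticTheory
open Literature.MathematicalPhysics.KineticTheory.PhononBoltzmann

namespace Summit.AtomisticToContinuum.FouriersLaw.Theorems.DrudeDissolution.KineticPolymerGasOnTheTimeAxis

/-! ### The resonance function -/

/-- The gapped band is `Cⁿ` for every `n` (`ω₂ > 0`). [folklore] -/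
theorem dispersion_contDiff {ω₂ : ℝ} (hω : 0 < ω₂) (n : WithTop ℕ∞) : ContDiff ℝ n (dispersion ω₂) :=
  (contDiff_iff_contDiffAt.2 fun k => (analyticAt_dispersion hω k).contDiffAt).of_le le_top

/-- **Registered sub-goal `resonanceFn_cell_contDiff` (C1): `Ω` read at `p = (k₁,(k₃,k₂))` is `Cⁿ`.** For `ω₂ > 0` and
every `n`, `ContDiff ℝ n (fun p : ℝ × ℝ × ℝ => resonanceFn ω₂ p.1 p.2.2 p.2.1)`. [folklore] -/
theorem resonanceFn_cell_contDiff :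
    ∀ ω₂ : ℝ, 0 < ω₂ → ∀ n : WithTop ℕ∞, ContDiff ℝ n (fun p : ℝ × ℝ × ℝ => resonanceFn ω₂ p.1 p.2.2 p.2.1) := by
  intro ω₂ hω n
  have hd := dispersion_contDiff hω n
  have c1 : ContDiff ℝ n fun p : ℝ × ℝ × ℝ => p.1 := contDiff_fst
  have c2 : ContDiff ℝ n fun p : ℝ × ℝ × ℝ => p.2.1 := contDiff_fst.comp contDiff_snd
  have c3 : ContDiff ℝ n fun p : ℝ × ℝ × ℝ => p.2.2 := contDiff_snd.comp contDiff_snd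
  unfold resonanceFn
  exact (((hd.comp c1).add (hd.comp c3)).sub (hd.comp c2)).sub (hd.comp ((c1.add c3).sub c2))

/-- `Ω` is `2π`-periodic in the first slot of `p = (k₁,(k₃,k₂))`. [folklore] -/
theorem resonanceFn_cell_periodic_fst (ω₂ : ℝ) (p : ℝ × ℝ × ℝ) :
    resonanceFn ω₂ (p.1 + 2 * Real.pi, p.2.1, p.2.2).1 (p.1 + 2 * Real.pi, p.2.1, p.2.2).2.2
        (p.1 + 2 * Real.pi, p.2.1, p.2.2).2.1 = resonanceFn ω₂ p.1 p.2.2 p.2.1 := by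
  have hp := dispersion_periodic ω₂
  simp only
  unfold resonanceFn
  rw [hp, show p.1 + 2 * Real.pi + p.2.2 - p.2.1 = (p.1 + p.2.2 - p.2.1) + 2 * Real.pi by ring, hp]

/-- `Ω` is `2π`-periodic in the middle slot of `p = (k₁,(k₃,k₂))`. [folklore] -/
theorem resonanceFn_cell_periodic_mid (ω₂ : ℝ) (p : ℝ × ℝ × ℝ) :
    resonanceFn ω₂ (p.1, p.2.1 + 2 * Real.pi, p.2.2).1 (p.1, p.2.1 + 2 * Real.pi, p.2.2).2.2
        (p.1, p.2.1 + 2 * Real.pi, p.2.2).2.1 = resonanceFn ω₂ p.1 p.2.2 p.2.1 := by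
  have hp := dispersion_periodic ω₂
  simp only
  unfold resonanceFn
  rw [hp, show p.1 + p.2.2 - (p.2.1 + 2 * Real.pi) = (p.1 + p.2.2 - p.2.1) - 2 * Real.pi by ring, hp.sub_eq]

/-- `Ω` is `2π`-periodic in the last slot of `p = (k₁,(k₃,k₂))`. [folklore] -/
theorem resonanceFn_cell_periodic_snd (ω₂ : ℝ) (p : ℝ × ℝ × ℝ) :
    resonanceFn ω₂ (p.1, p.2.1, p.2.2 + 2 * Real.pi).1 (p.1, p.2.1, p.2.2 + 2 * Real.pi).2.2
        (p.1, p.2.1, p.2.2 + 2 * Real.pi).2.1 = resonanceFn ω₂ p.1 p.2.2 p.2.1 := by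
  have hp := dispersion_periodic ω₂
  simp only
  unfold resonanceFn
  rw [hp, show p.1 + (p.2.2 + 2 * Real.pi) - p.2.1 = (p.1 + p.2.2 - p.2.1) + 2 * Real.pi by ring, hp]

/-! ### The excursion weight -/

/-- The quartic vertex is smooth in its three momenta (any fixed couplings). [folklore] -/
theorem vertex_cell_contDiff (a b : ℝ) (n : WithTop ℕ∞) :
    ContDiff ℝ n (fun p : ℝ × ℝ × ℝ => vertex a b p.1 p.2.2 p.2.1) := by
  unfold vertex
  fun_prop

/-- **Registered sub-goal `excursionWeight_contDiff` (C1): the bracket-weighted free pair weight is `Cⁿ`.** For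
`ω₂ > 0`, couplings `a, b` and a `Cⁿ` profile `f`, the weight
`W_f(p) = Φ(p)²/(ω₁ω₂ω₃ω₄)²·(f(k₁)+f(k₂)−f(k₃)−f(k₄))²` read at `p = (k₁,(k₃,k₂))` is `Cⁿ`. [folklore] -/
theorem excursionWeight_contDiff :
    ∀ ω₂ a b : ℝ, 0 < ω₂ → ∀ (n : WithTop ℕ∞) (f : ℝ → ℝ), ContDiff ℝ n f →
      ContDiff ℝ n (fun p : ℝ × ℝ × ℝ => vertex a b p.1 p.2.2 p.2.1 ^ 2 /
          (dispersion ω₂ p.1 * dispersion ω₂ p.2.2 * dispersion ω₂ p.2.1 *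
            dispersion ω₂ (p.1 + p.2.2 - p.2.1)) ^ 2 *
        (f p.1 + f p.2.2 - f p.2.1 - f (p.1 + p.2.2 - p.2.1)) ^ 2) := by
  intro ω₂ a b hω n f hf
  have hd := dispersion_contDiff hω n
  have c1 : ContDiff ℝ n fun p : ℝ × ℝ × ℝ => p.1 := contDiff_fst
  have c2 : ContDiff ℝ n fun p : ℝ × ℝ × ℝ => p.2.1 := contDiff_fst.comp contDiff_snd
  have c3 : ContDiff ℝ n fun p : ℝ × ℝ × ℝ => p.2.2 := contDiff_snd.comp contDiff_snd
  have c4 : ContDiff ℝ n fun p : ℝ × ℝ × ℝ => p.1 + p.2.2 - p.2.1 := (c1.add c3).sub c2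
  have hV := (vertex_cell_contDiff a b n).pow 2
  have hD : ContDiff ℝ n fun p : ℝ × ℝ × ℝ => (dispersion ω₂ p.1 * dispersion ω₂ p.2.2 * dispersion ω₂ p.2.1 *
      dispersion ω₂ (p.1 + p.2.2 - p.2.1)) ^ 2 :=
    ((((hd.comp c1).mul (hd.comp c3)).mul (hd.comp c2)).mul (hd.comp c4)).pow 2
  have hD0 : ∀ p : ℝ × ℝ × ℝ, (dispersion ω₂ p.1 * dispersion ω₂ p.2.2 * dispersion ω₂ p.2.1 *
      dispersion ω₂ (p.1 + p.2.2 - p.2.1)) ^ 2 ≠ 0 := fun p =>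
    pow_ne_zero _ (mul_pos (mul_pos (mul_pos (dispersion_pos hω _) (dispersion_pos hω _))
      (dispersion_pos hω _)) (dispersion_pos hω _)).ne'
  have hB : ContDiff ℝ n fun p : ℝ × ℝ × ℝ => (f p.1 + f p.2.2 - f p.2.1 - f (p.1 + p.2.2 - p.2.1)) ^ 2 :=
    ((((hf.comp c1).add (hf.comp c3)).sub (hf.comp c2)).sub (hf.comp c4)).pow 2
  exact (hV.div hD hD0).mul hB

/-- The excursion weight is non-negative. [folklore] -/
theorem excursionWeight_nonneg (ω₂ a b : ℝ) (f : ℝ → ℝ) (p : ℝ × ℝ × ℝ) :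
    0 ≤ vertex a b p.1 p.2.2 p.2.1 ^ 2 /
        (dispersion ω₂ p.1 * dispersion ω₂ p.2.2 * dispersion ω₂ p.2.1 * dispersion ω₂ (p.1 + p.2.2 - p.2.1)) ^ 2 *
      (f p.1 + f p.2.2 - f p.2.1 - f (p.1 + p.2.2 - p.2.1)) ^ 2 := by
  positivity

/-- The vertex is `2π`-periodic in `k₁` on the shell (two sine factors flip). [folklore] -/
theorem vertex_periodic₁ (a b k₁ k₂ k₃ : ℝ) : vertex a b (k₁ + 2 * Real.pi) k₂ k₃ = vertex a b k₁ k₂ k₃ := by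
  unfold vertex
  rw [show (k₁ + 2 * Real.pi) / 2 = k₁ / 2 + Real.pi by ring,
    show (k₁ + 2 * Real.pi + k₂ - k₃) / 2 = (k₁ + k₂ - k₃) / 2 + Real.pi by ring,
    Real.sin_add_pi, Real.sin_add_pi]
  ring

/-- The vertex is `2π`-periodic in `k₂` on the shell. [folklore] -/
theorem vertex_periodic₂ (a b k₁ k₂ k₃ : ℝ) : vertex a b k₁ (k₂ + 2 * Real.pi) k₃ = vertex a b k₁ k₂ k₃ := by
  unfold vertex
  rw [show (k₂ + 2 * Real.pi) / 2 = k₂ / 2 + Real.pi by ring,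
    show (k₁ + (k₂ + 2 * Real.pi) - k₃) / 2 = (k₁ + k₂ - k₃) / 2 + Real.pi by ring,
    Real.sin_add_pi, Real.sin_add_pi]
  ring

/-- The vertex is `2π`-periodic in `k₃` on the shell. [folklore] -/
theorem vertex_periodic₃ (a b k₁ k₂ k₃ : ℝ) : vertex a b k₁ k₂ (k₃ + 2 * Real.pi) = vertex a b k₁ k₂ k₃ := by
  unfold vertex
  rw [show (k₃ + 2 * Real.pi) / 2 = k₃ / 2 + Real.pi by ring,
    show (k₁ + k₂ - (k₃ + 2 * Real.pi)) / 2 = (k₁ + k₂ - k₃) / 2 - Real.pi by ring,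
    Real.sin_add_pi, Real.sin_sub_pi]
  ring

/-- **Registered sub-goal `excursionWeight_periodic` (C1): the excursion weight is `2π`-periodic in each slot of
`p = (k₁,(k₃,k₂))`** (for a `2π`-periodic profile `f`), in the three shapes consumed by
`cube_secondDiff_of_cutoffFamily`. [folklore] -/
theorem excursionWeight_periodic :
    ∀ ω₂ a b : ℝ, ∀ f : ℝ → ℝ, Function.Periodic f (2 * Real.pi) → ∀ p : ℝ × ℝ × ℝ,
      (vertex a b (p.1 + 2 * Real.pi) p.2.2 p.2.1 ^ 2 /
          (dispersion ω₂ (p.1 + 2 * Real.pi) * dispersion ω₂ p.2.2 * dispersion ω₂ p.2.1 *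
            dispersion ω₂ (p.1 + 2 * Real.pi + p.2.2 - p.2.1)) ^ 2 *
          (f (p.1 + 2 * Real.pi) + f p.2.2 - f p.2.1 - f (p.1 + 2 * Real.pi + p.2.2 - p.2.1)) ^ 2 =
        vertex a b p.1 p.2.2 p.2.1 ^ 2 /
          (dispersion ω₂ p.1 * dispersion ω₂ p.2.2 * dispersion ω₂ p.2.1 * dispersion ω₂ (p.1 + p.2.2 - p.2.1)) ^ 2 *
          (f p.1 + f p.2.2 - f p.2.1 - f (p.1 + p.2.2 - p.2.1)) ^ 2) ∧
      (vertex a b p.1 p.2.2 (p.2.1 + 2 * Real.pi) ^ 2 /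
          (dispersion ω₂ p.1 * dispersion ω₂ p.2.2 * dispersion ω₂ (p.2.1 + 2 * Real.pi) *
            dispersion ω₂ (p.1 + p.2.2 - (p.2.1 + 2 * Real.pi))) ^ 2 *
          (f p.1 + f p.2.2 - f (p.2.1 + 2 * Real.pi) - f (p.1 + p.2.2 - (p.2.1 + 2 * Real.pi))) ^ 2 =
        vertex a b p.1 p.2.2 p.2.1 ^ 2 /
          (dispersion ω₂ p.1 * dispersion ω₂ p.2.2 * dispersion ω₂ p.2.1 * dispersion ω₂ (p.1 + p.2.2 - p.2.1)) ^ 2 *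
          (f p.1 + f p.2.2 - f p.2.1 - f (p.1 + p.2.2 - p.2.1)) ^ 2) ∧
      (vertex a b p.1 (p.2.2 + 2 * Real.pi) p.2.1 ^ 2 /
          (dispersion ω₂ p.1 * dispersion ω₂ (p.2.2 + 2 * Real.pi) * dispersion ω₂ p.2.1 *
            dispersion ω₂ (p.1 + (p.2.2 + 2 * Real.pi) - p.2.1)) ^ 2 *
          (f p.1 + f (p.2.2 + 2 * Real.pi) - f p.2.1 - f (p.1 + (p.2.2 + 2 * Real.pi) - p.2.1)) ^ 2 =
        vertex a b p.1 p.2.2 p.2.1 ^ 2 /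
          (dispersion ω₂ p.1 * dispersion ω₂ p.2.2 * dispersion ω₂ p.2.1 * dispersion ω₂ (p.1 + p.2.2 - p.2.1)) ^ 2 *
          (f p.1 + f p.2.2 - f p.2.1 - f (p.1 + p.2.2 - p.2.1)) ^ 2) := by
  intro ω₂ a b f hf p
  have hp := dispersion_periodic ω₂
  refine ⟨?_, ?_, ?_⟩
  · rw [vertex_periodic₁, hp, hf,
      show p.1 + 2 * Real.pi + p.2.2 - p.2.1 = (p.1 + p.2.2 - p.2.1) + 2 * Real.pi by ring, hp, hf]
  · rw [vertex_periodic₃, hp, hf,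
      show p.1 + p.2.2 - (p.2.1 + 2 * Real.pi) = (p.1 + p.2.2 - p.2.1) - 2 * Real.pi by ring, hp.sub_eq, hf.sub_eq]
  · rw [vertex_periodic₂, hp, hf,
      show p.1 + (p.2.2 + 2 * Real.pi) - p.2.1 = (p.1 + p.2.2 - p.2.1) + 2 * Real.pi by ring, hp, hf]

end Summit.AtomisticToContinuum.FouriersLaw.Theorems.DrudeDissolution.KineticPolymerGasOnTheTimeAxis

end
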